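import Mathlib
import Summits.Ventures.PercRepro2.CrossAPrimeChain

/-!
# The second excess sign `E2Sign` as the hypothesis-free open statement
(blind cell PercRepro2, p5 g34; S4 §2.4 (s) addendum 27)

`MixedSign` (`E₂ ≥ B₃` along every root edge) is FALSE (exact witness: ref-2 g27, reproduced by
this seat), so the chain of open statements is re-based on the part of it the induction actually
uses: **`E2Sign`** := `0 ≤ E₂` along every random root edge `e = {r, w}` with `w ∉ {a₂, v}` —
hypothesis-free, and tight (`E₂ = 0` at a trivial root edge).  **`bernStep_of_e2Sign`**:
`3B₂ = E₂ + B₃ ≥ 0` and `3B₁ = E₁ + B₀ ≥ E₂ + B₀ ≥ 0` under the induction hypotheses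
(`E2_le_E1`), hence the sign of `crossA′so` for every weight vector and root
(**`crossA'so_nonneg_of_e2Sign`**) and row (LEAF-½) at a pendant root
(**`LeafRow_pendant_root_of_e2Sign`**).  Locally, `E₂ ≥ 0` follows from `0 ≤ first + M(m¹; m⁰)`
and `0 ≤ B₃` (`E2_nonneg_of_mixed`), so it holds at every pendant root with `0 ≤ B₃`
(`E2_nonneg_of_pendant`).  Own work; standard axioms.
-/

namespace Summit.Ventures.PercRepro2

open LeafRowPendantRootSO LeafStep LeafRowPendantRootMirrorB CrossAPrimeEdgeIdentities
  CrossAPrimeMixedSign CrossAPrimeBernStep CrossAPrimeChain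

namespace CrossAPrimeE2Sign

section Main

variable {V : Type*} {E : Type*} [Fintype E] [DecidableEq E] [Fintype V] [DecidableEq V]
  {R : Type*} [Field R] [LinearOrder R] [IsStrictOrderedRing R]
variable {ends : E → Sym2 V}

/-- **The second excess sign**: along every random root edge `e = {r, w}` (`w ∉ {a₂, v}`),
`0 ≤ E₂ = 3B₂ − B₃`, with no hypothesis. -/
def E2Sign (ends : E → Sym2 V) (o a₂ v b : V) : Prop :=
  ∀ (p : E → R) (r w : V) (e : E), IsProbVec p → ends e = s(r, w) → r ≠ w → w ≠ a₂ → w ≠ v →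
    p e ≠ 0 → p e ≠ 1 → 0 ≤ E2 p e ends o r a₂ v b

omit [Fintype V] in
/-- `E2Sign` gives `BernStep`: `3B₂ = E₂ + B₃` and `3B₁ = E₁ + B₀ ≥ E₂ + B₀`. -/
theorem bernStep_of_e2Sign {o a₂ v b : V} (H : E2Sign (R := R) ends o a₂ v b) :
    BernStep (R := R) ends o a₂ v b := by
  intro p r w e hp he hrw hw2 hwv h0 h1 hs0 hs1
  have hE2 := H p r w e hp he hrw hw2 hwv h0 h1
  have hE1 := E2_le_E1 hp he o a₂ v b
  exact ⟨by linarith, by linarith⟩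

/-- **The sign of `crossA′so` from `E2Sign`.** -/
theorem crossA'so_nonneg_of_e2Sign {o a₂ v b : V} (H : E2Sign (R := R) ends o a₂ v b) :
    ∀ (p : E → R), IsProbVec p → ∀ a₁, 0 ≤ crossA'so p ends o a₁ a₂ v b :=
  crossA'so_nonneg_of_bernStep (bernStep_of_e2Sign H)

/-- Row (LEAF-½) at a pendant root from `E2Sign`. -/
theorem LeafRow_pendant_root_of_e2Sign {o a₂ v b : V} (H : E2Sign (R := R) ends o a₂ v b)
    {p : E → R} (hp : IsProbVec p) {e : E} {z : V} (hleaf : ∀ f, a₂ ∈ ends f → f = e)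
    (hends : ends e = s(a₂, z)) {a₁ : V} (ho : o ≠ a₂) (h1 : a₁ ≠ a₂) (hv : v ≠ a₂) (hb : b ≠ a₂)
    (hrow : LeafRow (Function.update p e 1) ends o a₁ a₂ v b) : LeafRow p ends o a₁ a₂ v b :=
  LeafRow_pendant_root_of_bernStep (bernStep_of_e2Sign H) hp hleaf hends ho h1 hv hb hrow

omit [Fintype V] [DecidableEq V] in
/-- Locally, `0 ≤ first + M(m¹; m⁰)` and `0 ≤ B₃` give `0 ≤ E₂` (`E₂ = B₃ + first + M(m¹; m⁰)`). -/
theorem E2_nonneg_of_mixed (p : E → R) (e : E)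
    (o a₁ a₂ v b : V) (h3 : 0 ≤ crossA'so (Function.update p e 1) ends o a₁ a₂ v b)
    (hmix : 0 ≤ first p e ends o a₁ a₂ v b +
      mixed (Function.update p e 1) (Function.update p e 0) ends o a₁ a₂ v b) :
    0 ≤ E2 p e ends o a₁ a₂ v b := by
  have := E2_sub_B3 p e ends o a₁ a₂ v b
  linarith

/-- At a pendant root (every other edge at `a₁` of weight `0`), `0 ≤ B₃` gives `0 ≤ E₂`. -/
theorem E2_nonneg_of_pendant {p : E → R} (hp : IsProbVec p) {e : E} {a₁ w : V}
    (he : ends e = s(a₁, w)) (hpend : ∀ f, a₁ ∈ ends f → f ≠ e → p f = 0) (o a₂ : V) {v : V}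
    (hv : v ≠ a₁) (b : V) (h3 : 0 ≤ crossA'so (Function.update p e 1) ends o a₁ a₂ v b) :
    0 ≤ E2 p e ends o a₁ a₂ v b := by
  apply E2_nonneg_of_mixed p e o a₁ a₂ v b h3
  rw [mixed_update_eq_zero_of_pendant hpend o a₂ hv b, add_zero]
  exact first_nonneg hp he o a₂ v b

end Main

end CrossAPrimeE2Sign

end Summit.Ventures.PercRepro2
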